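import Literature.Analysis.Distribution.DivFormLocalSolvability
import HarnessLib

/-!
# Local solvability, with small `L²` norm, of linear elliptic equations with smooth coefficients
# and smooth right-hand side (any smooth presentation, `2k > n`)

Analysis/Distribution support file (everything proved; no definitions, no named facts), sequel of
`DivFormLocalSolvability.lean` (the divergence-form case), on the discharge path of
`Literature.Geometry.Lorentzian.mullerZumHagen1970_analytic_of_timelikeKilling` (Müller zum Hagen
1970: the harmonic coordinates adapted to a stationary Killing field are local solutions of a
linear elliptic equation with smooth coefficients on the 3-dimensional quotient; Müller zum Hagen
cites Bers–John–Schechter, *Partial Differential Equations* (1964), Part II, Ch. 5, for their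
existence). Here the operator is an arbitrary smooth presentation `P = ∑_{w ∈ S} a_w X_w`
(`smoothDiffOp`, `EllipticRegularity.lean`) elliptic of order `k` near `x₀` with `2k > dim E`:

* `IsEllipticOn.mono'` — ellipticity restricts to subsets;
* `continuousOn_smoothDiffOp_of_contDiffOn` — `P w` is continuous on an open set on which `w` is
  smooth (locality of `P`, `smoothDiffOp_eventuallyEq`);
* `exists_smooth_solution_of_isEllipticOn` — **local solvability**: there are `ε₀ > 0` and
  `C ≥ 0` such that for all `0 < ε ≤ ε₀` and all `G ∈ C^∞(E)` there is `w`, `C^∞` on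
  `B(x₀, ε)`, with `P w = G` on `B(x₀, ε)` and `∫_{B(x₀,ε)} w² dμ ≤ C μ(B(x₀,ε))² M²` whenever
  `|G| ≤ M` on `B̄(x₀, ε)`; `exists_smooth_solution_of_isEllipticOn'` also records that `w²` is
  integrable on the ball (the solution is a.e. an `L²(μ)` function there).

Proof (Hörmander's duality method; Folland 1995, Thm. (8.45), for smooth right-hand sides): the
formal transpose `ᵗP` has a smooth presentation `Q`, elliptic of the same order
(`exists_smoothDiffOp_transpose`); by the a priori inequality `|φ(y)| ≤ C₀ ‖Q φ‖_{L²}` for test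
functions on a small ball (`exists_apriori_smoothDiffOp_forall`), the functional
`Q φ ↦ ∫ G φ dμ` on `Q(𝓓(B_ε)) ⊆ L²(μ)` is bounded by `C₀ μ(B_ε) M`; Hahn–Banach and Riesz give
`u ∈ L²(μ)`, `‖u‖ ≤ C₀ μ(B_ε) M`, with `∫ u ᵗPφ = ∫ G φ`, i.e. `P u = G` in `𝓓'(B_ε)`; Folland's
Cor. (6.34) (`Folland1995_cor634_holds`) makes `u` smooth on `B_ε`, and integrating by parts
(`integral_smoothDiffOp_mul'`) the smooth representative solves `P w = G` classically.

## References

* G. B. Folland, *Introduction to Partial Differential Equations*, 2nd ed. (1995), Thm. (8.45),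
  Cor. (6.34). [Folland2020]
* L. Hörmander, *The Analysis of Linear Partial Differential Operators I–II* (1990), §7.9,
  Thm. 13.3.3 (folklore).
* L. Bers, F. John, M. Schechter, *Partial Differential Equations* (1964), Part II, Ch. 5.
* H. Müller zum Hagen, Proc. Camb. Phil. Soc. 68 (1970) 199–201. [MullerZumHagen1970]
-/

noncomputable section

open MeasureTheory Set Filter Function TopologicalSpace Real Metric Distributions
open scoped Topology InnerProductSpace ContDiff ENNReal NNReal

namespace Literature.Analysis.Distribution

open Literature.Analysis.Hypoelliptic

section General

-- `E : Type` (universe `0`) as in `DivFormRegularity.lean`, whose cut-off lemma is used below.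
variable {E : Type} [NormedAddCommGroup E] [NormedSpace ℝ E]
  {ι : Type*} {X : ι → E → E} {S : Finset (List ι)} {a : List ι → E → ℝ} {k : ℕ}

/-- Ellipticity on a set passes to subsets. [folklore] -/
theorem IsEllipticOn.mono' {s t : Set E} (h : IsEllipticOn X S a k s) (hts : t ⊆ s) :
    IsEllipticOn X S a k t :=
  ⟨h.1, fun x hx ↦ h.2 x (hts hx)⟩

variable [FiniteDimensional ℝ E]

/-- **Locality**: `P w` is continuous on an open set `U` on which `w` is `C^∞` (at each point
`P w` agrees near the point with `P (χ w)` for a cut-off `χ = 1` near the point, supported in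
`U`). [folklore] -/
theorem continuousOn_smoothDiffOp_of_contDiffOn (hX : ∀ i, ContDiff ℝ ∞ (X i))
    (ha : ∀ w ∈ S, ContDiff ℝ ∞ (a w)) {U : Set E} (hU : IsOpen U) {w : E → ℝ}
    (hw : ContDiffOn ℝ ∞ w U) : ContinuousOn (smoothDiffOp X S a w) U := by
  intro y hy
  obtain ⟨r, hr, hrU⟩ := Metric.isOpen_iff.1 hU y hy
  obtain ⟨χ, hχs, -, hχU, hχ1⟩ := exists_bump (isCompact_closedBall y (r / 2)) hU
    ((closedBall_subset_ball (by linarith)).trans hrU)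
  have hws : ContDiff ℝ ∞ fun x ↦ χ x * w x := contDiff_mul_of_tsupport_subset hU hχs hχU hw
  have hloc : ∀ z ∈ ball y (r / 2), smoothDiffOp X S a w z = smoothDiffOp X S a (fun x ↦ χ x * w x) z := by
    intro z hz
    have hev : w =ᶠ[𝓝 z] fun x ↦ χ x * w x := by
      filter_upwards [isOpen_ball.mem_nhds hz] with x hx
      rw [hχ1 x (ball_subset_closedBall hx), one_mul]
    exact (smoothDiffOp_eventuallyEq X S a hev).self_of_nhds
  have hcont : ContinuousAt (smoothDiffOp X S a fun x ↦ χ x * w x) y :=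
    (contDiff_smoothDiffOp hX ha hws).continuous.continuousAt
  refine (hcont.continuousWithinAt.congr_of_eventuallyEq ?_ ?_)
  · filter_upwards [mem_nhdsWithin_of_mem_nhds (isOpen_ball.mem_nhds (mem_ball_self (by positivity) :
      y ∈ ball y (r / 2)))] with z hz
    exact hloc z hz
  · exact hloc y (mem_ball_self (by positivity))

end General

/-! ### Local solvability for an arbitrary elliptic smooth presentation -/

section Solvability

variable {E : Type} [NormedAddCommGroup E] [NormedSpace ℝ E] [FiniteDimensional ℝ E]
  [MeasurableSpace E] [BorelSpace E] (μ : Measure E) [μ.IsAddHaarMeasure]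
  {ι : Type} {X : ι → E → E} {S : Finset (List ι)} {a : List ι → E → ℝ} {k : ℕ}

/-- **Local solvability of linear elliptic equations with smooth coefficients, with small `L²`
norm — form recording the square-integrability of the solution on the ball** (the solution is
a.e. equal on the ball to an `L²(μ)` function). Same statement and proof as
`exists_smooth_solution_of_isEllipticOn` below, with `w² ∈ L¹(B(x₀, ε))` added to the
conclusion (needed by the interior estimates of the sequel). Folland 1995, Thm. (8.45), for smooth
right-hand sides. [cite: Folland2020, Thm. (8.45) and Cor. (6.34)] -/
theorem exists_smooth_solution_of_isEllipticOn' [Nontrivial E] [DecidableEq ι]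
    (hX : ∀ i, ContDiff ℝ ∞ (X i)) (ha : ∀ w, ContDiff ℝ ∞ (a w))
    {Ω : Set E} (hΩ : IsOpen Ω) (hell : IsEllipticOn X S a k Ω)
    (hk : (Module.finrank ℝ E : ℝ) < 2 * k) {x₀ : E} (hx₀ : x₀ ∈ Ω) :
    ∃ ε₀ : ℝ, 0 < ε₀ ∧ ∃ C : ℝ, 0 ≤ C ∧ ∀ ε : ℝ, 0 < ε → ε ≤ ε₀ →
      ∀ G : E → ℝ, ContDiff ℝ ∞ G →
        ∃ w : E → ℝ, ContDiffOn ℝ ∞ w (ball x₀ ε) ∧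
          (∀ x ∈ ball x₀ ε, smoothDiffOp X S a w x = G x) ∧
          IntegrableOn (fun x ↦ w x ^ 2) (ball x₀ ε) μ ∧
          ∀ M : ℝ, (∀ x ∈ closedBall x₀ ε, |G x| ≤ M) →
            ∫ x in ball x₀ ε, w x ^ 2 ∂μ ≤ C * (μ (ball x₀ ε)).toReal ^ 2 * M ^ 2 := by
  classical
  have haS : ∀ w ∈ S, ContDiff ℝ ∞ (a w) := fun w _ ↦ ha w
  -- the transpose presentation `Q = (X, S', a')`, elliptic of order `k` on `Ω`
  obtain ⟨S', a', ha', hk', hP', hsymb⟩ := exists_smoothDiffOp_transpose hX haS hell.1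
  set a'' : List ι → E → ℝ := fun w ↦ if w ∈ S' then a' w else 0 with ha''
  have ha''s : ∀ w, ContDiff ℝ ∞ (a'' w) := by
    intro w
    by_cases hw : w ∈ S'
    · rw [ha'']; dsimp only; rw [if_pos hw]; exact ha' w hw
    · rw [ha'']; dsimp only; rw [if_neg hw]; exact contDiff_const
  have ha''S : ∀ w ∈ S', ContDiff ℝ ∞ (a'' w) := fun w _ ↦ ha''s w
  have hQeq : ∀ g : E → ℝ, smoothDiffOp X S' a'' g = smoothDiffOp X S' a' g := by
    intro g
    funext x
    unfold smoothDiffOp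
    exact Finset.sum_congr rfl fun w hw ↦ by rw [ha'']; dsimp only; rw [if_pos hw]
  have hQ : ∀ {g : E → ℝ}, ContDiff ℝ ∞ g → ∀ x,
      smoothDiffOp X S' a'' g x = smoothDiffOpTranspose X S a g x := by
    intro g hg x
    rw [hQeq g, hP' g hg]
  have hellQ : IsEllipticOn X S' a'' k Ω := by
    refine ⟨fun w hw ↦ hk' w hw, fun x hx ξ hξ ↦ ?_⟩
    have hsym : principalSymbol X S' a'' k x ξ = principalSymbol X S' a' k x ξ := by
      unfold principalSymbol
      refine Finset.sum_congr rfl fun w hw ↦ ?_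
      rw [Finset.mem_filter] at hw
      rw [ha'']; dsimp only; rw [if_pos hw.1]
    rw [hsym, hsymb]
    exact mul_ne_zero (pow_ne_zero _ (by norm_num)) (hell.2 x hx ξ hξ)
  -- the a priori estimate for `Q`
  obtain ⟨U, hUo, hx₀U, hUΩ, C₀, hC₀, hest⟩ :=
    exists_apriori_smoothDiffOp_forall μ hX ha''s hΩ hellQ hk hx₀
  obtain ⟨ε₀, hε₀, hballU⟩ := Metric.isOpen_iff.1 hUo x₀ hx₀U
  refine ⟨ε₀, hε₀, C₀ ^ 2, by positivity, fun ε hε hεε₀ G hG ↦ ?_⟩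
  -- the ball
  set B : Set E := ball x₀ ε with hB
  have hBo : IsOpen B := isOpen_ball
  let Bo : Opens E := ⟨B, hBo⟩
  have hBU : B ⊆ U := (ball_subset_ball hεε₀).trans hballU
  have hBΩ : B ⊆ Ω := hBU.trans hUΩ
  have hμB : μ B < ⊤ := measure_ball_lt_top
  have hBm : MeasurableSet B := measurableSet_ball
  set V : ℝ := (μ B).toReal with hV
  have hV0 : 0 ≤ V := ENNReal.toReal_nonneg
  -- a bound for `G` on the closed ball
  obtain ⟨M₀, hM₀⟩ := (isCompact_closedBall x₀ ε).exists_bound_of_continuousOn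
    hG.continuous.continuousOn
  have hM₀' : ∀ x ∈ closedBall x₀ ε, |G x| ≤ M₀ := fun x hx ↦ by
    rw [← Real.norm_eq_abs]; exact hM₀ x hx
  -- `Q φ ∈ L²(μ)` for test functions on the ball
  have hQs : ∀ φ : 𝓓(Bo, ℝ), ContDiff ℝ ∞ (smoothDiffOp X S' a'' φ) := fun φ ↦
    contDiff_smoothDiffOp hX ha''S φ.contDiff
  have hQsupp : ∀ φ : 𝓓(Bo, ℝ), tsupport (smoothDiffOp X S' a'' φ) ⊆ B := fun φ ↦
    (tsupport_smoothDiffOp_subset S' a'' _).trans φ.tsupport_subset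
  have hQc : ∀ φ : 𝓓(Bo, ℝ), HasCompactSupport (smoothDiffOp X S' a'' φ) := fun φ ↦
    φ.hasCompactSupport.mono' ((subset_tsupport _).trans (tsupport_smoothDiffOp_subset S' a'' _))
  have hmem : ∀ φ : 𝓓(Bo, ℝ), MemLp (smoothDiffOp X S' a'' φ) 2 μ := fun φ ↦
    (hQs φ).continuous.memLp_of_hasCompactSupport (hQc φ)
  -- the linear map `φ ↦ [Q φ] ∈ L²(μ)`
  let Tm : 𝓓(Bo, ℝ) →ₗ[ℝ] Lp ℝ 2 μ :=
    { toFun := fun φ ↦ (hmem φ).toLp _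
      map_add' := fun φ ψ ↦ by
        refine Lp.ext_iff.2 ?_
        filter_upwards [(hmem (φ + ψ)).coeFn_toLp, (hmem φ).coeFn_toLp, (hmem ψ).coeFn_toLp,
          Lp.coeFn_add ((hmem φ).toLp _) ((hmem ψ).toLp _)] with x h1 h2 h3 h4
        rw [h4, Pi.add_apply, h1, h2, h3]
        have e : ((φ + ψ : 𝓓(Bo, ℝ)) : E → ℝ) = (φ : E → ℝ) + (ψ : E → ℝ) := rfl
        rw [e, smoothDiffOp_add hX S' a'' φ.contDiff ψ.contDiff, Pi.add_apply]
      map_smul' := fun r φ ↦ by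
        refine Lp.ext_iff.2 ?_
        filter_upwards [(hmem (r • φ)).coeFn_toLp, (hmem φ).coeFn_toLp,
          Lp.coeFn_smul r ((hmem φ).toLp _)] with x h1 h2 h4
        rw [RingHom.id_apply, h4, Pi.smul_apply, h1, h2, smul_eq_mul]
        have e : ((r • φ : 𝓓(Bo, ℝ)) : E → ℝ) = fun y ↦ r * φ y := rfl
        rw [e, smoothDiffOp_const_mul S' a'' r] }
  have hTm : ∀ φ : 𝓓(Bo, ℝ), Tm φ = (hmem φ).toLp _ := fun φ ↦ rfl
  have hTm_norm : ∀ φ : 𝓓(Bo, ℝ), ‖Tm φ‖ = (eLpNorm (smoothDiffOp X S' a'' φ) 2 μ).toReal :=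
    fun φ ↦ by rw [hTm, Lp.norm_toLp]
  -- the a priori bound on the ball and the bound of the functional `φ ↦ ∫ G φ`
  have hsup : ∀ φ : 𝓓(Bo, ℝ), ∀ y, |φ y| ≤ C₀ * ‖Tm φ‖ := fun φ y ↦ by
    rw [hTm_norm]; exact hest φ φ.contDiff (φ.tsupport_subset.trans hBU) y
  have hGφi : ∀ φ : 𝓓(Bo, ℝ), Integrable (fun x ↦ G x * φ x) μ := fun φ ↦
    (hG.continuous.mul φ.continuous).integrable_of_hasCompactSupport φ.hasCompactSupport.mul_left
  have hbound : ∀ M : ℝ, (∀ x ∈ closedBall x₀ ε, |G x| ≤ M) → ∀ φ : 𝓓(Bo, ℝ),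
      |∫ x, G x * φ x ∂μ| ≤ C₀ * V * M * ‖Tm φ‖ := by
    intro M hM φ
    have hMnn : 0 ≤ M := (abs_nonneg _).trans (hM x₀ (mem_closedBall_self hε.le))
    have hpt : ∀ x, ‖G x * φ x‖ ≤ B.indicator (fun _ ↦ M * (C₀ * ‖Tm φ‖)) x := by
      intro x
      by_cases hx : x ∈ B
      · rw [indicator_of_mem hx, Real.norm_eq_abs, abs_mul]
        exact mul_le_mul (hM x (ball_subset_closedBall hx)) (hsup φ x) (abs_nonneg _) hMnn
      · have hx' : x ∉ tsupport (φ : E → ℝ) := fun h ↦ hx (φ.tsupport_subset h)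
        rw [indicator_of_notMem hx, image_eq_zero_of_notMem_tsupport hx', mul_zero, norm_zero]
    have hint' : IntegrableOn (fun _ : E ↦ M * (C₀ * ‖Tm φ‖)) B μ :=
      integrableOn_const (hs := hμB.ne) (hC := enorm_ne_top)
    have hint : Integrable (B.indicator fun _ ↦ M * (C₀ * ‖Tm φ‖)) μ :=
      hint'.integrable_indicator hBm
    have h := norm_integral_le_of_norm_le hint (Eventually.of_forall hpt)
    rw [integral_indicator_const _ hBm, Real.norm_eq_abs, smul_eq_mul, Measure.real, ← hV] at h
    calc |∫ x, G x * φ x ∂μ| ≤ V * (M * (C₀ * ‖Tm φ‖)) := h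
      _ = C₀ * V * M * ‖Tm φ‖ := by ring
  -- the functional on `𝓓(B)`, the kernel inclusion, Hahn–Banach and Riesz
  let ev : 𝓓(Bo, ℝ) →ₗ[ℝ] ℝ :=
    { toFun := fun φ ↦ ∫ x, G x * φ x ∂μ
      map_add' := fun φ ψ ↦ by
        have e : ((φ + ψ : 𝓓(Bo, ℝ)) : E → ℝ) = (φ : E → ℝ) + (ψ : E → ℝ) := rfl
        simp only [e, Pi.add_apply, mul_add]
        exact integral_add (hGφi φ) (hGφi ψ)
      map_smul' := fun r φ ↦ by
        have e : ((r • φ : 𝓓(Bo, ℝ)) : E → ℝ) = fun y ↦ r * φ y := rfl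
        simp only [e, RingHom.id_apply, smul_eq_mul, ← integral_const_mul]
        exact integral_congr_ae (Eventually.of_forall fun x ↦ by ring) }
  have hker : LinearMap.ker Tm ≤ LinearMap.ker ev := by
    intro φ hφ
    rw [LinearMap.mem_ker] at hφ ⊢
    have h := hbound M₀ hM₀' φ
    rw [hφ, norm_zero, mul_zero] at h
    exact abs_nonpos_iff.1 h
  let ℓ₀ : LinearMap.range Tm →ₗ[ℝ] ℝ :=
    ((LinearMap.ker Tm).liftQ ev hker).comp Tm.quotKerEquivRange.symm.toLinearMap
  have hℓ₀ : ∀ φ : 𝓓(Bo, ℝ), ℓ₀ ⟨Tm φ, LinearMap.mem_range_self Tm φ⟩ = ∫ x, G x * φ x ∂μ := by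
    intro φ
    change ((LinearMap.ker Tm).liftQ ev hker) (Tm.quotKerEquivRange.symm ⟨Tm φ, _⟩) = _
    rw [LinearMap.quotKerEquivRange_symm_apply_image Tm φ (LinearMap.mem_range_self Tm φ)]
    rfl
  have hℓ₀b : ∀ M : ℝ, (∀ x ∈ closedBall x₀ ε, |G x| ≤ M) →
      ∀ w : LinearMap.range Tm, ‖ℓ₀ w‖ ≤ C₀ * V * M * ‖w‖ := by
    rintro M hM ⟨w, hw⟩
    obtain ⟨φ, rfl⟩ := LinearMap.mem_range.1 hw
    rw [hℓ₀ φ, Real.norm_eq_abs]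
    exact hbound M hM φ
  let ℓ₁ : LinearMap.range Tm →L[ℝ] ℝ := ℓ₀.mkContinuous (C₀ * V * M₀) (hℓ₀b M₀ hM₀')
  have hℓ₁n : ∀ M : ℝ, (∀ x ∈ closedBall x₀ ε, |G x| ≤ M) → ‖ℓ₁‖ ≤ C₀ * V * M := by
    intro M hM
    have hMnn : 0 ≤ M := (abs_nonneg _).trans (hM x₀ (mem_closedBall_self hε.le))
    exact ContinuousLinearMap.opNorm_le_bound _ (by positivity) (hℓ₀b M hM)
  obtain ⟨g, hg, hgn⟩ := exists_extension_norm_eq (LinearMap.range Tm) ℓ₁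
  set u₂ : Lp ℝ 2 μ := (InnerProductSpace.toDual ℝ (Lp ℝ 2 μ)).symm g with hu₂
  have hu₂n : ‖u₂‖ = ‖ℓ₁‖ := by rw [hu₂, LinearIsometryEquiv.norm_map, hgn]
  have hu₂ : ∀ φ : 𝓓(Bo, ℝ), ∫ x, u₂ x * smoothDiffOp X S' a'' φ x ∂μ = ∫ x, G x * φ x ∂μ := by
    intro φ
    have h1 : ⟪u₂, Tm φ⟫_ℝ = ∫ x, G x * φ x ∂μ := by
      rw [hu₂, InnerProductSpace.toDual_symm_apply, hg ⟨Tm φ, LinearMap.mem_range_self Tm φ⟩]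
      exact hℓ₀ φ
    rw [← h1, MeasureTheory.L2.inner_def]
    refine integral_congr_ae ?_
    filter_upwards [(hmem φ).coeFn_toLp] with x hx
    rw [hTm, hx]
    simp only [RCLike.inner_apply, conj_trivial]
    ring
  have hmemu : MemLp (u₂ : E → ℝ) 2 μ := Lp.memLp u₂
  have hu₂sq : ∫ x, (u₂ : E → ℝ) x ^ 2 ∂μ = ‖u₂‖ ^ 2 := by
    rw [← real_inner_self_eq_norm_sq, MeasureTheory.L2.inner_def]
    refine integral_congr_ae (Eventually.of_forall fun x ↦ ?_)
    simp only [RCLike.inner_apply, conj_trivial]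
    ring
  -- regularity: `u₂` is smooth on `B` (Folland's Cor. (6.34) for `P` itself)
  have hloc : LocallyIntegrableOn (u₂ : E → ℝ) B μ :=
    (hmemu.locallyIntegrable one_le_two).locallyIntegrableOn _
  let uD : 𝓓'(Bo, ℝ) :=
    (TestFunction.integralAgainstBilinCLM (ContinuousLinearMap.mul ℝ ℝ) μ (u₂ : E → ℝ) :
      𝓓(Bo, ℝ) →L[ℝ] ℝ)
  have huD : ∀ φ : 𝓓(Bo, ℝ), uD φ = ∫ x, φ x * u₂ x ∂μ := by
    intro φ
    change TestFunction.integralAgainstBilinCLM (ContinuousLinearMap.mul ℝ ℝ) μ (u₂ : E → ℝ) φ = _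
    rw [TestFunction.integralAgainstBilinCLM_eq_integral hloc]
    simp
  have hhyp : IsHypoellipticOn Bo (smoothDiffOpTranspose X S a) μ :=
    Folland1995_cor634_holds E μ ι Bo X S a k hX haS (hell.mono' hBΩ)
  have himg : Distribution.ImageIsSmoothOn uD (smoothDiffOpTranspose X S a) μ B := by
    refine ⟨G, hG.contDiffOn, fun φ ψ _ hψ ↦ ?_⟩
    rw [huD ψ, ← hu₂ φ]
    refine integral_congr_ae (Eventually.of_forall fun x ↦ ?_)
    dsimp only
    rw [hψ, hQ φ.contDiff x, mul_comm]
  obtain ⟨w, hw, hwint⟩ := hhyp uD B hBo Subset.rfl himg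
  -- `u₂ = w` a.e. on `B`
  have hwB : LocallyIntegrableOn w B μ := hw.continuousOn.locallyIntegrableOn hBm
  have hz : ∀ᵐ x ∂μ, x ∈ B → (u₂ : E → ℝ) x = w x := by
    have h0 := hBo.ae_eq_zero_of_integral_contDiff_smul_eq_zero (μ := μ)
      (f := fun x ↦ (u₂ : E → ℝ) x - w x) (hloc.sub hwB) (fun g hg hgc hgU ↦ by
        let φg : 𝓓(Bo, ℝ) := ⟨g, hg, hgc, hgU⟩
        have h1 : ∫ x, g x * u₂ x ∂μ = ∫ x, w x * g x ∂μ := by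
          have := hwint φg hgU
          rw [huD] at this
          exact this
        have hi1 : Integrable (fun x ↦ g x * u₂ x) μ :=
          TestFunction.integrable_bilin (ContinuousLinearMap.mul ℝ ℝ) hloc φg
        have hi2 : Integrable (fun x ↦ g x * w x) μ :=
          TestFunction.integrable_bilin (ContinuousLinearMap.mul ℝ ℝ) hwB φg
        simp only [smul_eq_mul, mul_sub]
        rw [integral_sub hi1 hi2, h1, sub_eq_zero]
        exact integral_congr_ae (Eventually.of_forall fun x ↦ mul_comm _ _))
    filter_upwards [h0] with x hx hxB
    exact sub_eq_zero.1 (hx hxB)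
  -- the weak equation for `w`: `∫ w ᵗPφ = ∫ G φ`
  have hweak : ∀ φ : 𝓓(Bo, ℝ), ∫ x, w x * smoothDiffOp X S' a'' φ x ∂μ = ∫ x, G x * φ x ∂μ := by
    intro φ
    rw [← hu₂ φ]
    refine integral_congr_ae ?_
    filter_upwards [hz] with x hx
    by_cases hxB : x ∈ B
    · rw [hx hxB]
    · have hx' : x ∉ tsupport (smoothDiffOp X S' a'' φ) := fun h ↦ hxB (hQsupp φ h)
      rw [image_eq_zero_of_notMem_tsupport hx', mul_zero, mul_zero]
  have hwi : IntegrableOn (fun x ↦ w x ^ 2) B μ := by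
    have h1 : IntegrableOn (fun x ↦ (u₂ : E → ℝ) x ^ 2) B μ := hmemu.integrable_sq.integrableOn
    refine Integrable.congr h1 ?_
    refine (ae_restrict_iff' hBm).2 ?_
    filter_upwards [hz] with x hx hxB
    rw [hx hxB]
  refine ⟨w, hw, ?_, hwi, ?_⟩
  · -- the classical equation on `B`
    set F : E → ℝ := fun y ↦ smoothDiffOp X S a w y - G y with hF
    have hFc : ContinuousOn F B :=
      (continuousOn_smoothDiffOp_of_contDiffOn hX haS hBo hw).sub hG.continuous.continuousOn
    have hFint : ∀ φ : E → ℝ, ContDiff ℝ ∞ φ → HasCompactSupport φ → tsupport φ ⊆ B →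
        ∫ x, φ x • F x ∂μ = 0 := by
      intro φ hφ hφc hφB
      obtain ⟨W, hWo, hφW, hWB, hWc⟩ :=
        exists_open_between_and_isCompact_closure hφc hBo hφB
      obtain ⟨χ, hχs, hχc, hχB, hχ1⟩ := exists_bump hWc hBo hWB
      set wt : E → ℝ := fun x ↦ χ x * w x with hwt
      have hwts : ContDiff ℝ ∞ wt := contDiff_mul_of_tsupport_subset hBo hχs hχB hw
      have hwtc : HasCompactSupport wt := hχc.mul_right
      have hwtW : ∀ y ∈ W, wt =ᶠ[𝓝 y] w := by
        intro y hy
        filter_upwards [hWo.mem_nhds hy] with z hz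
        rw [hwt]; dsimp only; rw [hχ1 z (subset_closure hz), one_mul]
      let φt : 𝓓(Bo, ℝ) := ⟨φ, hφ, hφc, hφB⟩
      -- `∫ G φ = ∫ w Qφ = ∫ wt ᵗPφ = ∫ (P wt) φ = ∫ (P w) φ`
      have h1 : ∫ x, G x * φ x ∂μ = ∫ x, wt x * smoothDiffOpTranspose X S a φ x ∂μ := by
        have hw' := hweak φt
        change ∫ x, w x * smoothDiffOp X S' a'' φ x ∂μ = ∫ x, G x * φ x ∂μ at hw'
        rw [← hw']
        refine integral_congr_ae (Eventually.of_forall fun x ↦ ?_)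
        dsimp only
        by_cases hxW : x ∈ W
        · rw [(hwtW x hxW).self_of_nhds, hQ hφ x]
        · have hx' : x ∉ tsupport (smoothDiffOp X S' a'' φ) := fun h ↦
            hxW (hφW (tsupport_smoothDiffOp_subset S' a'' _ h))
          have hx'' : x ∉ tsupport (smoothDiffOpTranspose X S a φ) := fun h ↦
            hxW (hφW (tsupport_smoothDiffOpTranspose_subset S a _ h))
          rw [image_eq_zero_of_notMem_tsupport hx', image_eq_zero_of_notMem_tsupport hx'',
            mul_zero, mul_zero]
      have h2 : ∫ x, wt x * smoothDiffOpTranspose X S a φ x ∂μ =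
          ∫ x, smoothDiffOp X S a wt x * φ x ∂μ :=
        (integral_smoothDiffOp_mul' (μ := μ) hX haS hwts hφ hwtc).symm
      have h3 : ∀ x, smoothDiffOp X S a wt x * φ x = φ x * smoothDiffOp X S a w x := by
        intro x
        by_cases hxW : x ∈ W
        · rw [(smoothDiffOp_eventuallyEq X S a (hwtW x hxW)).self_of_nhds, mul_comm]
        · have hx' : x ∉ tsupport φ := fun h ↦ hxW (hφW h)
          rw [image_eq_zero_of_notMem_tsupport hx', zero_mul, mul_zero]
      have hGφ : Integrable (fun x ↦ G x * φ x) μ :=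
        (hG.continuous.mul hφ.continuous).integrable_of_hasCompactSupport hφc.mul_left
      have hLφ : Integrable (fun x ↦ φ x * smoothDiffOp X S a w x) μ := by
        have : (fun x ↦ φ x * smoothDiffOp X S a w x) = fun x ↦ smoothDiffOp X S a wt x * φ x :=
          funext fun x ↦ (h3 x).symm
        rw [this]
        exact ((contDiff_smoothDiffOp hX haS hwts).continuous.mul hφ.continuous)
          |>.integrable_of_hasCompactSupport hφc.mul_left
      have h4 : ∫ x, G x * φ x ∂μ = ∫ x, φ x * smoothDiffOp X S a w x ∂μ := by
        rw [h1, h2]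
        exact integral_congr_ae (Eventually.of_forall h3)
      have h5 : (fun x ↦ φ x • F x) = fun x ↦ φ x * smoothDiffOp X S a w x - G x * φ x := by
        funext x; rw [hF]; simp only [smul_eq_mul]; ring
      rw [h5, integral_sub hLφ hGφ, ← h4, sub_self]
    have hae := hBo.ae_eq_zero_of_integral_contDiff_smul_eq_zero (μ := μ)
      (hFc.locallyIntegrableOn hBm) hFint
    intro x hx
    by_contra hne
    have hFx : F x ≠ 0 := fun h ↦ hne (sub_eq_zero.1 h)
    have hO : IsOpen (B ∩ F ⁻¹' {0}ᶜ) := hFc.isOpen_inter_preimage hBo isOpen_compl_singleton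
    have hpos' : 0 < μ (B ∩ F ⁻¹' {0}ᶜ) := hO.measure_pos μ ⟨x, hx, hFx⟩
    have hnull : μ (B ∩ F ⁻¹' {0}ᶜ) = 0 := by
      refine measure_mono_null (fun y hy ↦ ?_) (ae_iff.1 hae)
      exact fun h ↦ hy.2 (h hy.1)
    exact hpos'.ne' hnull
  · -- the `L²` bound
    intro M hM
    have h1 : ∫ x in B, w x ^ 2 ∂μ = ∫ x in B, (u₂ : E → ℝ) x ^ 2 ∂μ := by
      refine setIntegral_congr_ae hBm ?_
      filter_upwards [hz] with x hx hxB
      rw [hx hxB]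
    have h2 : ∫ x in B, (u₂ : E → ℝ) x ^ 2 ∂μ ≤ ∫ x, (u₂ : E → ℝ) x ^ 2 ∂μ :=
      setIntegral_le_integral hmemu.integrable_sq (Eventually.of_forall fun x ↦ sq_nonneg _)
    have h3 : ‖u₂‖ ≤ C₀ * V * M := hu₂n ▸ hℓ₁n M hM
    calc ∫ x in B, w x ^ 2 ∂μ ≤ ‖u₂‖ ^ 2 := by rw [h1, ← hu₂sq]; exact h2
      _ ≤ (C₀ * V * M) ^ 2 := pow_le_pow_left₀ (norm_nonneg _) h3 2
      _ = C₀ ^ 2 * V ^ 2 * M ^ 2 := by ring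

/-- **Local solvability of linear elliptic equations with smooth coefficients, with small `L²`
norm** (Folland 1995, Thm. (8.45), for smooth right-hand sides; the existence input of harmonic /
stationary-harmonic coordinates, Müller zum Hagen 1970, p. 200, via Bers–John–Schechter 1964,
Part II, Ch. 5). Let `P = ∑_{w ∈ S} a_w X_w` be a smooth presentation on `E ≅ ℝⁿ` (`n ≥ 1`, Haar
measure `μ`), elliptic of order `k` on the open set `Ω ∋ x₀`, with `2k > n`. Then there are
`ε₀ > 0` and `C ≥ 0` such that for all `0 < ε ≤ ε₀` and all `G ∈ C^∞(E)` there is `w`, `C^∞` on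
`B(x₀, ε)`, with `P w = G` on `B(x₀, ε)` and `∫_{B(x₀,ε)} w² dμ ≤ C μ(B(x₀,ε))² M²` whenever
`|G| ≤ M` on `B̄(x₀, ε)`. See the module docstring for the proof.
[cite: Folland2020, Thm. (8.45) and Cor. (6.34)] -/
theorem exists_smooth_solution_of_isEllipticOn [Nontrivial E] [DecidableEq ι]
    (hX : ∀ i, ContDiff ℝ ∞ (X i)) (ha : ∀ w, ContDiff ℝ ∞ (a w))
    {Ω : Set E} (hΩ : IsOpen Ω) (hell : IsEllipticOn X S a k Ω)
    (hk : (Module.finrank ℝ E : ℝ) < 2 * k) {x₀ : E} (hx₀ : x₀ ∈ Ω) :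
    ∃ ε₀ : ℝ, 0 < ε₀ ∧ ∃ C : ℝ, 0 ≤ C ∧ ∀ ε : ℝ, 0 < ε → ε ≤ ε₀ →
      ∀ G : E → ℝ, ContDiff ℝ ∞ G →
        ∃ w : E → ℝ, ContDiffOn ℝ ∞ w (ball x₀ ε) ∧
          (∀ x ∈ ball x₀ ε, smoothDiffOp X S a w x = G x) ∧
          ∀ M : ℝ, (∀ x ∈ closedBall x₀ ε, |G x| ≤ M) →
            ∫ x in ball x₀ ε, w x ^ 2 ∂μ ≤ C * (μ (ball x₀ ε)).toReal ^ 2 * M ^ 2 := by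
  obtain ⟨ε₀, hε₀, C, hC, h⟩ := exists_smooth_solution_of_isEllipticOn' μ hX ha hΩ hell hk hx₀
  refine ⟨ε₀, hε₀, C, hC, fun ε hε hεε₀ G hG ↦ ?_⟩
  obtain ⟨w, hw, hweq, -, hwb⟩ := h ε hε hεε₀ G hG
  exact ⟨w, hw, hweq, hwb⟩

end Solvability

end Literature.Analysis.Distribution
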